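import Summits.QuantumFields.BalabanUV.T4Continuum.Support.ShellMeasureLandauEndAssembledDecayCfV6
import Summits.QuantumFields.BalabanUV.T4Continuum.Support.ShellMeasureLinearChartMap

/-!
v6 RE-ROOT (owner R-ne7cp1-g37-1 (c3) «THE MIDDLE», unit `b2b-balaban-t4-ne7c-formalise-leaf-03` gen 9; chain suffix `V6`∕`_v6`,
R-ne7cp1-g37-3 (b)): THIS MODULE IS `ShellMeasureLandauEndAssembledDecayCfLin` (ROW S104 f2, leaf-10-g13) REGENERATED MECHANICALLY over link 3 `ShellMeasureLandauEndAssembledDecayCfV6` — the chain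
rooted at leaf-07-g10's S112 f3 `ShellMeasureLandauEndRayStokesAssembledDecayV6` (the Wilson budgets `hqW hk` in print's (53)–(54)
field-size shape, S112; the 𝓔-leg read on the w-tuple's pinned dress, S113 = leaf-01-g11's `ShellMeasureRayTermsPinnedLandauW`) — by
`g9/src/relink/relink.py` (the old surgery re-applied to the new host; ONE BY-NAME call; conclusion = the host's).  BINDER DIFF vs `ShellMeasureLandauEndAssembledDecayCfLin` (`linkdiff.py` on the bytes):
LEAVE = `Se Se' h52loce ϖe₁ ϖe₂ hϖe₁ hϖe₂ r₀e hreache Λe 𝔄 δ' ϖ hδ' hϖ 𝒵e ℬe 𝒢e W𝒱e B₀e C₄e a₃e be h𝒢e hWe hB₀e hC₄e hbe H₁e hH₁e Te rΦe hTbe hSre ιe hιe He hHe`;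
ENTER = `hϖ0 hB𝒢w hBH₁w hBHw hιew`; TYPE-CHANGED = `hqW hk hdome hselfe hcontre hqe hRCe Ef hEb supp hblind hdepth hK hcoupE hElb₁ hRdict`; conclusion = the
host's re-spelled slot constant.  No hand edit in this link.
HONEST (c3): re-wiring of OUR typed chain; nothing of Bałaban's asserted, cited or discharged; every CONTENT row stays displayed; NOTHING
in the countdown moves; NE7c NOT PRINTED, NOT PROVED; spine 0∕9.  THE OLD MODULE's DOCSTRING FOLLOWS VERBATIM FOR PROVENANCE (read
«imports X» as «imports X·V6»; its LEAVING∕ENTERING lists describe the OLD step, unchanged relative to the v6 host).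
# `T4Continuum.ShellMeasureLandauEndAssembledDecayCfLin` — «WALL ROW R10 IN KERNEL — THE LINEAR CHART MAP», file 2: THE
# MOST-ASSEMBLED ONE-SLOT END OF RECORD WITH R11 SUPPLIED (S99 f3b `ShellMeasureLandauEndAssembledDecayCf`) RE-FIRED WITH ITS
# THREE COARSE-DATUM MAPS LINEAR — R10's nine analytic binders (`hΦd hΦ0 hΦ`, `hΦdw hΦ0w hΦbw`, `hΦde hΦ0e hΦbe`) DISCHARGED;
# in their place THREE number relations `‖T V‖·r_Φ < b`; everything else VERBATIM; conclusion IDENTICAL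
(cell `pub-balaban`, sub-cell `t4`, spine estimate NE7c (node U5b); NE7c ROUND-2 crew `t4-ne7c-formalise-*`, unit
`b2b-balaban-t4-ne7c-formalise-leaf-10` gen 13; owner table `t4/b2b-balaban-t4-ne7c-p1/LEAVES-NE7c-P1.md` row **S104** «WALL ROW R10 IN
KERNEL — THE LINEAR CHART MAP» (own-initiative OFFER O-ne7cL10g13-1 journal l.20903; owner GO R-ne7cp1-g36-2 l.21166 with the three
HONEST CAVEATS below verbatim), file 2 of the row (file 1a `ShellMeasureLinearChartMap` = the R10 triple for ANY continuous linear
chart map; file 1b `ShellMeasureLinearChartBlock` = the designed instance); ADDITIVE — imports S99 f3b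
`ShellMeasureLandauEndAssembledDecayCf` (p235614, leaf-07-g9) + file 1a ONLY; [folklore]; ONE theorem, 0 `def`, 0 `def … : Prop`,
0 sorry, 0 citation tags)

HONEST FRAMING.  Finite four-torus programme, rung (B)+1 only — NOT infinite volume, NOT a mass gap, NOT the Clay problem, NOT
summit progress; (B), `BetaPertHyp`, (B^μ) not consumed.  NE7c (`T4IndicatorShell.ShellWeightBound` for the cell's expansions) is
NOT PRINTED in [Balaban 1983–89] and NOT PROVED; «NE7c ⇐ the named binders» (trigger c3); (M1) realized ≠ NE7c.  PLUMBING ON OUR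
SIDE: what leaves the hypothesis list is OUR analytic threading of a map that is LINEAR BY CONSTRUCTION of OUR chart; nothing of
Bałaban's is asserted, cited or discharged; every estimate binder of S99 f3b stays DISPLAYED.  HONEST DEPENDENCY (cell): continuum
YM on T⁴ ⇐ BetaPertH ∧ nine spine estimates (0/9 proved); BetaPertH ⇐ (D1) ∧ (D4) ∧ CAP+tail; G-an2-4 gates asym, D1 and NE2/3/4.

THE POINT (owner census `t4/b2b-balaban-t4-ne7c-p1/ONECALL-CENSUS-NE7c.md` row R10 «chart map `Φ`, `hΦd hΦ0 hΦ` (`r_Φ`,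
`b = 2dLC₁ε₁`; B11 (75)∕(44); [T] W-a; node O», 15 names ∕ 9 hyp; WALL §3 W-a locator table: «(75)∕(44) `Φ` … elementary ONCE node
O fixes the chart (likely a linear embedding)»).  S99 f3b — the END that THE ONE CALL v2 (S102) composes — takes per scheme tuple a
coarse-datum map `Φ : GaugeField P j SU2 → (Fin m₀ → ℂ) → ℬ` with the analytic triple `DifferentiableOn ℂ (Φ V) (ball 0 rΦ)`,
`Φ V 0 = 0`, `‖Φ V z‖ < b` on the ball.  READING (locator, NOT a citation, nothing asserted): [Balaban1985Variational] p. 284 (42)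
«`Q(ηA) = B` on `𝔅_k`, `|B| < 2dLC₁ε₁`», p. 289 (75) «`L_jηQ_jA′ = B` on `Λ_j`»: `B` is the CONSTRAINT DATUM — and in the
analyticity statement the END hosts mirror (Sect. G p. 305: «if `V = V′V₀`, `V′` small, `U₀ = U_k(V₀)` … it is an analytic function of
`B = (1∕i) log V′`»; (172) «`V′ = e^{iB′}`, `|B′| < 2C₁ε₁`»; (174) «`𝓗 = 𝒜₁ + H₁B`» = the hosts' `solAt … (H₁ V (Φ V ·)) + H₁ V (Φ V ·)`;
Prop. 9 p. 309 «`B = (1∕i) log V′`») the BONDWISE LOGARITHM of the coarse field relative to the centre —, which in OUR exponential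
chart `expFibreChart Λ 1 e`
(`x ↦ (b ↦ exp(ι x_{e(b,·)}))`) is the chart coordinate itself, regrouped per bond and read by the fibre's coordinate map, zero off
the block: a bounded complex-LINEAR map (file 1b `ShellMeasureLinearChartBlock.blockChart`∕`pinChart`).  THIS FILE re-fires f3b with
`Φ := fun V => ⇑(T V)`, `Φw := fun V => ⇑(Tw V)`, `Φe := fun V => ⇑(Te V)` for CLM families `T Tw Te`:
* LEAVING (R10, 9 hypotheses of printed TYPE + 3 data): `Φ hΦd hΦ0 hΦ`, `Φw hΦdw hΦ0w hΦbw`, `Φe hΦde hΦ0e hΦbe` — supplied by file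
  1a's `hΦd_of_linear` (a CLM is entire), `hΦ0_of_linear` (`map_zero`), `hΦ_of_linear` (`‖T V z‖ ≤ ‖T V‖‖z‖ < b`).
* ENTERING (3 data + 3 hypotheses): the CLM families `T Tw Te` and the number relations `hTb : ∀ V, ‖T V‖·rΦ < 2·dL·C₁·ε₁`,
  `hTbw : ∀ V, ‖Tw V‖·rΦw < bw`, `hTbe : ∀ V, ‖Te V‖·rΦe < be` — operator norm × polydisc radius against B11's `b` (OUR number
  junction, class N in the owner's census — see caveat (2); for the designed map `‖T‖ ≤ ‖κ‖`, file 1b); the radii `rΦ rΦw rΦe` STAY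
  (they sit in (SM)'s currency `Rad = rΦ∕S` — `hsm` — and in the conclusion's constant).
* RESTATED for the linear maps (same count, same class): the reality rows `hTr : ∀ V y, T V (cplx y) ∈ 𝓡ℬ`, `hTrw` («T is real on
  real points»; f3b's window restriction `‖y‖ ≤ S` is idle — file 1a `hΦr_of_linear`) and the block-support row `hsupp` (for `Tw`).
* VERBATIM: every other binder of f3b (box∕comb∕chart, density∕variable∕co-tests, the three scheme tuples with R11 supplied, the
  decay kernels and row sums, localities, read-outs, real structures, frozen plaquettes, (T3)∕(S78) data, [dict] `hRdict`∕`hudict`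
  — with `T V (cplx y)` in place of `Φ V (cplx y)` —, numbers, (SM) in the Stokes currency, the γ3 pair); CONCLUSION IDENTICAL to
  f3b's (M1) at `εθ·η²` with the same slot constant.  Proof = ONE call of f3b BY NAME.
EXPECTED CENSUS EFFECT when THE ONE CALL is re-pointed here (row S105, the generator holder's mechanical re-run; the owner's
`onecall_census.py` prints the truth): R10's 9 [T] hypotheses leave, 3 class-N relations enter (R10p) — [T] hyp 95 → 86, N 14 → 17 on
top of S102's 103 → 95 (R-ne7cp1-g36-2).
HONEST CAVEATS (owner R-ne7cp1-g36-2 (a), VERBATIM).  (1) Linearity holds exactly when the chart centre IS print's `V₀` (the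
configuration whose minimiser is the expansion point) — that identification is R04∕R03p's reading and stays node O's sentence inside
`hRdict`∕`hudict` [O]; for a centre `c ≠ V₀`, `B = 1∕i·log(c·e^{y}·V₀⁻¹)` is NOT linear, so S104 f2 is the LINEAR SPECIAL CASE of S99
f3b, which STAYS in the tree for the general centre (no deprecation).  (2) The entering `hTb : ‖T V‖·rΦ < 2dLC₁ε₁` (×3) is OUR
number junction «complex chart polydisc ⊂ the b-ball of (42)∕(75)» — CLASS N (same drawer as R14 `hsm`), NOT [D]: it is not an
inequality print displays; WALL §2 (e)'s radius demand (T-NE7c-11: `Rad = rΦ∕S ≥ r₀∕ε_j` against `‖T‖·rΦ < b`, hence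
`‖T‖·S < b·ε_j∕r₀`) is UNCHANGED by the re-typing and stays «met in kind, NOT located as a number» [R].  (3) `‖T‖` absorbs the `L^jη`
of (75) and the norm of `ℬ` (a located number).  ALSO: whether Bałaban's datum for the block-sectioned configuration IS `T V (cplx y)`
is node O's sentence (`hRdict`∕`hudict`, class O — UNCHANGED).  CONDITIONAL on every binder; readings NOT asserted; NOT Bałaban's
minimiser; (M1) realized ≠ NE7c; NOTHING in the countdown moves; NE7c NOT PROVED; spine PROVED 0∕9.
-/

noncomputable section

open Set Metric NormedSpace MeasureTheory Function

namespace Summit.QuantumFields.BalabanUV.T4Continuum.ShellMeasureLandauEndAssembledDecayCfLinV6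

open scoped ENNReal
open Literature.MathematicalPhysics.QuantumFieldTheory.Balaban1983to89
open B11Prop6Scheme (Prop4Hyp)
open GaugeField (GaugeInvariant)
open T4ShellMeasure (SlotAntiConcentration)
open T4CubePoincare (cube)
open T4CubeChartGnomonic (SU2)
open T4CubeChartExp (expFibreChart)
open T4TreeGaugeFixing (NoClosedLoop fixTo noClosedLoop_combBonds)
open T4ShellMeasurePlaquette (expTail₂)
open ShellMeasureLevelAssembly (classifier)
open ShellMeasureMultiGridNorms (WSup)
open ShellMeasurePinnedNorm (pinW kerOpPin)
open ShellMeasureMultiGridNorms.WSup (toPiL)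
open ShellMeasureLandauHolonomy (solAt landauExp)
open ShellMeasureLandauHolonomyChart (holOf cplx)
open ShellMeasureLandauHolonomySkew (readOutReal)
open ShellMeasureRayTermsPinnedLandauW (hE_landau_chartRay_pinned_w)
open ShellMeasureRayLogIntegral (rayBound_of_logIntegral rayBound_add)
open ShellMeasureLandauEndFinal (slotAC_realized_su2_landauChart_final)
open ShellMeasureLandauEndRayStokesAssembled (wilsonProfile_nonneg)
open ShellMeasureDecayKernelSums (kerOp)
open ShellMeasureLandauWilsonSquaresKernelsSchwarzField (hE_landau_wilsonSquares_located_schwarz_of_decay_field)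
open ShellMeasureRayTermsPinnedLandau (hE_landau_chartRay_pinned completeSpace_wsup)
open ShellMeasureLandauEndWindowRestrictRel (slotAC_realized_su2_landauChart_final_of_reach')
open T4AxialGaugeSmallField (boxPlaqs boxBonds)
open T4AxialGaugeFixing (combBonds)
open ShellMeasureWindowReachCollar (hreach'_of_core_collar)
open ShellMeasureLandauEndWindowReach (reach_family_inhabited)
open ShellMeasureLevelZeroBoxWitness (toyParams blockBonds boxPlaqF)
open ShellMeasureLandauEndAssembledDecayReachV6 (slotAC_realized_su2_landauChart_assembled_decay_v6_of_reach')
open B7Prop2Explicit (C0 c2' unitaryUnits avgClosed_unitaryUnits)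
open B7Prop1Local (pdevOn loK bondHiK)
open B7Prop5Flat (BondIn)
open ShellMeasureAverageProp4General (C1cov O1cov C2cov C1cov_pos)
open ShellMeasureLandauCorrectionB7 (landauCf landauRad)
open ShellMeasureLandauCorrectionReal (skewPi isClosed_skewPi)
open ShellMeasureLandauCfBoxLocal (landauCfBox landauCfBox_local landauCfBox_real_binders_local)
open ShellMeasureLandauCorrectionB7Local (landauCorrection_real_binders_flat landauCorrection_binders_local)
open ShellMeasureAverageLocality148 (landauCf_congr)
open ShellMeasureLandauCfPinned (conj_binders_of_local C2cov_nonneg)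
open ShellMeasureLandauEndAssembledDecayReachBoxV6 (slotAC_realized_su2_landauChart_assembled_decay_v6_of_core_collar)
open ShellMeasureLinearChartMap (hΦd_of_linear hΦ0_of_linear hΦ_of_linear hΦr_of_linear)
open ShellMeasureLandauEndAssembledDecayCfV6 (slotAC_realized_su2_landauChart_assembled_decay_v6_cfB7)

section Box

open scoped Matrix.Norms.L2Operator

variable {P : Params} {j : ℕ} [DecidableEq (PBond P j)]
variable {n : Type*} [Fintype n] [DecidableEq n] [Nonempty n]
variable {𝒴 𝒵 ℬ : Type*} [NormedAddCommGroup 𝒴] [NormedSpace ℂ 𝒴] [CompleteSpace 𝒴]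
  [NormedAddCommGroup 𝒵] [NormedSpace ℂ 𝒵] [NormedAddCommGroup ℬ] [NormedSpace ℂ ℬ]
variable {𝔸 : Type*} [CStarAlgebra 𝔸] [Nontrivial 𝔸]

/-- **THE MOST-ASSEMBLED ONE-SLOT END WITH R11 AND R10 SUPPLIED** — S99 f3b `…_assembled_decay_cfB7` with its three coarse-datum
maps LINEAR: `Φ := fun V => ⇑(T V)`, `Φw := fun V => ⇑(Tw V)`, `Φe := fun V => ⇑(Te V)` for continuous-linear-map families
`T Tw Te` on the chart coordinates `Fin m₀ → ℂ`; R10's nine analytic binders DISCHARGED (file 1a: a CLM is entire, maps `0 ↦ 0`,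
and `‖T V z‖ ≤ ‖T V‖‖z‖`), the three number relations `‖T V‖·rΦ < 2dLC₁ε₁`, `‖Tw V‖·rΦw < bw`, `‖Te V‖·rΦe < be` DISPLAYED instead;
the reality rows and the block-support row restated for the linear maps; everything else VERBATIM; conclusion IDENTICAL.
CONDITIONAL on every binder; readings NOT asserted; NOT Bałaban's minimiser (node O); (M1) realized ≠ NE7c. [folklore] -/
theorem slotAC_realized_su2_landauChart_assembled_decay_v6_cfB7_lin
    -- the BOX `[lo, hi]` (the block `□^{∼4}`: `nb` unit steps per direction, non-wrapping on the torus) and its axial comb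
    {lo hi : Fin P.d → ℤ} {nb : ℕ} (hn : ∀ κ, hi κ ≤ lo κ + nb) (hN : ∀ κ, hi κ - lo κ < P.sitesPerDir j)
    (Λ : Finset (PBond P j)) (hΛbox : ∀ b ∈ Λ, b ∈ boxBonds lo hi) (hΛcomb : Disjoint Λ (combBonds lo hi)) {m₀ : ℕ}
    (e : ↥Λ × Fin 3 ≃ Fin m₀) {S : ℝ} (hS : 0 < S) (hSπ : 3 * S ^ 2 < Real.pi ^ 2) {F : GaugeField P j SU2 → ℝ≥0∞}
    (hF : Measurable F) (hFi : GaugeInvariant F) {u : GaugeField P j SU2 → ℝ} (hu : Measurable u)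
    (hui : GaugeInvariant u) {ι : Type*} {Pu : Finset ι} (hPu : Pu.Nonempty)
    (W : GaugeField P j SU2 → Set (Fin m₀ → ℝ)) (Jco : GaugeField P j SU2 → (Fin m₀ → ℝ) → ℝ≥0∞) {δ ρ β : ℝ}
    (𝒢 : GaugeField P j SU2 → (𝒵 →L[ℂ] 𝒴)) (W𝒱 : GaugeField P j SU2 → 𝒴 → 𝒵) {B₀ C₄ a₃ ε₄ : ℝ}
    (h𝒢 : ∀ V f, ‖𝒢 V f‖ ≤ B₀ * ‖f‖) (hW : ∀ V, Prop4Hyp (W𝒱 V) C₄ a₃) (hB₀ : 0 < B₀) (hC₄ : 0 ≤ C₄) (hε₄ : 0 ≤ ε₄)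
    {dL C₁ B₃ ε₁ : ℝ} (hdL : 0 ≤ dL) (hC₁ : 0 ≤ C₁) (hε₁ : 0 ≤ ε₁) (hB₃ : dL ≤ B₃) (h1 : 2 * B₀ * C₁ * B₃ * ε₁ ≤ ε₄)
    (h2 : 4 * ε₄ ≤ a₃) (h3 : 16 * B₀ * C₄ * ε₄ ≤ 1) (H₁ : GaugeField P j SU2 → (ℬ →L[ℂ] 𝒴))
    (hH₁ : ∀ V B, ‖H₁ V B‖ ≤ B₀ * ‖B‖)
    -- ══ R10 SUPPLIED (this file): the u-tuple's coarse-datum map IS a bounded complex-LINEAR map `T V` read on the chart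
    -- coordinates — its three analytic binders `hΦd hΦ0 hΦ` are DISCHARGED (`ShellMeasureLinearChartMap`); DISPLAYED in
    -- their place: ONE number relation «operator norm × polydisc radius < B11's `b = 2dLC₁ε₁`» ══
    (T : GaugeField P j SU2 → ((Fin m₀ → ℂ) →L[ℂ] ℬ)) {rΦ : ℝ} (hTb : ∀ V, ‖T V‖ * rΦ < 2 * dL * C₁ * ε₁)
    (hSr : S < rΦ)
    -- ══ R11 SUPPLIED (row S99, γ14): the THREE Landau-correction letters ARE the tree's `C_k` of [B7] Prop. 4 in the
    -- `A`-currency (S64 `landauCf`), all with `C₂ := C2cov d`, `RC := landauRad d L`: u-tuple (LOCALIZED, flat background —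
    -- its plaquette variables are words of the exponent field alone) `Cf V := (ball 0 RC).indicator (C_k(1, ·))`, NOTHING
    -- displayed in its place; w-tuple (GLOBAL minimiser, flat pi-types) `Cw V := landauCfBox L (Ubg V) k Sw Sw′ RC` (cut off
    -- PER OUTPUT BOND on its box — exact locality `hlocC` by `landauCfBox_local`); e-tuple (GLOBAL minimiser, pinned) `Ce V :=`
    -- CfP's conjugate of `C_k(Ubg V, ·)` with `C₂e := C2cov d·e^{2δ′r₀e}`.  `hC₂ hCq hCd hCr h𝓡𝒳 ∕ hC₂w hCqw hCdw hlocC hCrw h𝓡𝒳w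
    -- ∕ hC₂e hCqe hCde` DISCHARGED (f1 §5, f3a §2–§3).  DISPLAYED IN THEIR PLACE (w∕e only): the global minimiser's background
    -- `Ubg V` on `ℤᵈ` (unitary-valued) and its plaquette regularity ON THE BOXES of the two output index sets ONLY — `h52locw`,
    -- `h52loce` (B11 Thm 1 ∕ (19)–(21) TYPE, class T until node O reads it off the co-tests) — four LEVEL-FREE numbers on `α₀`
    -- (class D), the e-letter's two pin profiles with CfP's reach `r₀e` ([R]); [dict]: `k` = the slot's level ══
    (k : ℕ) (Sf Sf' Sw Sw' : Finset (B7Prop1Explicit.Site P.d × Fin P.d))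
    (Ubg : GaugeField P j SU2 → B7Prop1Explicit.Site P.d → Fin P.d → 𝔸ˣ) (hUbg : ∀ V x κ, Ubg V x κ ∈ unitaryUnits 𝔸)
    {α₀ : ℝ} (hα : 0 < α₀) (hα3 : C0 P.d * α₀ ≤ 1 / 3) (hα4 : 4 * α₀ ≤ c2' P.d P.L) (hα6 : 4 * O1cov P.d * α₀ ≤ 1 / 3)
    (h52locw : ∀ V (c : ↥Sw'),
      pdevOn (loK P.L k c.1.1) (bondHiK P.L k c.1.1 c.1.2) (Ubg V) < α₀ * (((P.L : ℝ) ^ k)⁻¹) ^ 2)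
    (ιs : GaugeField P j SU2 → (𝒴 →L[ℂ] (↥Sf → 𝔸))) (hι : ∀ V Y, ‖ιs V Y‖ ≤ ‖Y‖)
    (Hop : GaugeField P j SU2 → ((↥Sf' → 𝔸) →L[ℂ] 𝒴)) (hH : ∀ V X, ‖Hop V X‖ ≤ B₀ * ‖X‖) {ε₃ : ℝ}
    (h18 : 18 * C2cov P.d * B₀ * ε₃ ≤ 1) (hcoup : ε₄ + B₀ * (2 * dL * C₁ * ε₁) ≤ ε₃)
    (h3R : 3 * ε₃ ≤ landauRad P.d P.L) (ℓs : ι → List (𝒴 →L[ℂ] Matrix n n ℂ)) {κr : ℝ} (hκ : 0 ≤ κr)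
    (hℓ : ∀ p ∈ Pu, ∀ ℓ ∈ ℓs p, ∀ Y, ‖ℓ Y‖ ≤ κr * ‖Y‖) {m : ℕ} (hlen : ∀ p ∈ Pu, (ℓs p).length ≤ m) {κc : ℝ}
    (hκc : 0 ≤ κc) (hcurl : ∀ p ∈ Pu, ∀ Y, ‖((ℓs p).map fun ℓ => ℓ Y).sum‖ ≤ κc * ‖Y‖)
    -- ══ (T2) THE WILSON SLOT'S SUPPLIER DATA AT THE READING OF RECORD (file 4
    -- `ShellMeasureLandauWilsonSquaresKernelsSchwarz.hE_landau_wilsonSquares_located_schwarz_of_decay`, per exterior section `V`,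
    -- V-uniform constants): five FLAT pi-type chain spaces, ONE pin profile on a common position space (one-sided Lipschitz),
    -- the four linear letters as V-indexed DECAY KERNELS with reduced-rate row sums ((3.133)∕Thm 3.3, (46), (103) decay-halves
    -- TYPE — LOCATORS), the flat printed-TYPE lists, two localities with reaches, the block support of the coarse field, blind
    -- flat read-outs, the located count — NOTHING PINNED DISPLAYED; the Wilson budget LOCATED and SECOND ORDER (γ6) ══
    {Λw Λz Λb 𝔖 : Type*} [Fintype Λw] [DecidableEq Λw] [Fintype Λz] [Fintype Λb] {𝔄w ℭ 𝔇 : Type*}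
    [NormedAddCommGroup 𝔄w] [NormedSpace ℂ 𝔄w] [CompleteSpace 𝔄w] [NormedAddCommGroup ℭ] [NormedSpace ℂ ℭ]
    [NormedAddCommGroup 𝔇] [NormedSpace ℂ 𝔇] {δw : ℝ} (hδw : 0 ≤ δw) (ϖw : 𝔖 → ℝ) (dis : 𝔖 → 𝔖 → ℝ)
    (hϖw : ∀ x y, ϖw x ≤ ϖw y + dis x y) (pos : Λw → 𝔖) (posz : Λz → 𝔖) (pos' : ↥Sw → 𝔖) (posx : ↥Sw' → 𝔖)
    (posb : Λb → 𝔖) (k𝒢 : GaugeField P j SU2 → Λw → Λz → (ℭ →L[ℂ] 𝔄w))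
    (kι : GaugeField P j SU2 → ↥Sw → Λw → (𝔄w →L[ℂ] 𝔸)) (kH : GaugeField P j SU2 → Λw → ↥Sw' → (𝔸 →L[ℂ] 𝔄w))
    (kH₁ : GaugeField P j SU2 → Λw → Λb → (𝔇 →L[ℂ] 𝔄w)) {c𝒢 δ𝒢 M𝒢 cι δι Mι cH δH MH cH₁ δH₁ MH₁ : ℝ} (hc𝒢 : 0 ≤ c𝒢)
    (hM𝒢 : 0 ≤ M𝒢) (hk𝒢 : ∀ V c b', ‖k𝒢 V c b'‖ ≤ c𝒢 * Real.exp (-(δ𝒢 * dis (pos c) (posz b'))))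
    (hM𝒢' : ∀ x, ∑ b', Real.exp (-((δ𝒢 - δw) * dis x (posz b'))) ≤ M𝒢) (hcι : 0 ≤ cι) (hMι : 0 ≤ Mι)
    (hkι : ∀ V c b', ‖kι V c b'‖ ≤ cι * Real.exp (-(δι * dis (pos' c) (pos b'))))
    (hMι' : ∀ x, ∑ b', Real.exp (-((δι - δw) * dis x (pos b'))) ≤ Mι) (hcH : 0 ≤ cH) (hMH : 0 ≤ MH)
    (hkH : ∀ V c b', ‖kH V c b'‖ ≤ cH * Real.exp (-(δH * dis (pos c) (posx b'))))
    (hMH' : ∀ x, ∑ b', Real.exp (-((δH - δw) * dis x (posx b'))) ≤ MH) (hcH₁ : 0 ≤ cH₁) (hMH₁ : 0 ≤ MH₁)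
    (hkH₁ : ∀ V c b', ‖kH₁ V c b'‖ ≤ cH₁ * Real.exp (-(δH₁ * dis (pos c) (posb b'))))
    (hMH₁' : ∀ x, ∑ b', Real.exp (-((δH₁ - δw) * dis x (posb b'))) ≤ MH₁)
    -- the flat lists (P2)∕(P4)∕(118)∕(121)∕(103)∕(75)-TYPE∕(44) at radius `RCw` with `6(ε₄w + B₀w·bw) ≤ RCw`∕scaling∕(46)∕(54)
    (W𝒱w : GaugeField P j SU2 → (Λw → 𝔄w) → (Λz → ℭ)) {B₀w C₄w a₃w ε₄w bw : ℝ}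
    (h𝒢w : ∀ V f, ‖kerOp (k𝒢 V) f‖ ≤ B₀w * ‖f‖) (hWw : ∀ V, Prop4Hyp (W𝒱w V) C₄w a₃w) (hB₀w : 0 < B₀w)
    (hC₄w : 0 ≤ C₄w) (hε₄w : 0 ≤ ε₄w) (hdomw : 2 * (ε₄w + B₀w * bw) ≤ a₃w)
    (hselfw : B₀w * C₄w * (ε₄w + B₀w * bw) ^ 2 ≤ ε₄w) (hcontrw : 4 * B₀w * C₄w * (ε₄w + B₀w * bw) < 1)
    (hH₁w : ∀ V B, ‖kerOp (kH₁ V) B‖ ≤ B₀w * ‖B‖)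
    -- ══ R10 SUPPLIED: the w-tuple's coarse-datum map is a bounded LINEAR map into the flat pi-type; ONE number relation ══
    (Tw : GaugeField P j SU2 → ((Fin m₀ → ℂ) →L[ℂ] (Λb → 𝔇))) {rΦw : ℝ} (hTbw : ∀ V, ‖Tw V‖ * rΦw < bw)
    (h2Sw : 2 * S ≤ rΦw) (hιw : ∀ V Y, ‖kerOp (kι V) Y‖ ≤ ‖Y‖) (hHw : ∀ V X, ‖kerOp (kH V) X‖ ≤ B₀w * ‖X‖)
    (hqw : 9 * C2cov P.d * B₀w * (ε₄w + B₀w * bw) < 1) (hRCw : 6 * (ε₄w + B₀w * bw) ≤ landauRad P.d P.L)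
    -- localities with reaches, the block support, the two contraction numbers (DISPLAYED arithmetic on the decay constants)
    (NW : Λz → Λw → Prop)
    (hlocW : ∀ V, ∀ A A' : Λw → 𝔄w, ∀ c', (∀ b', NW c' b' → A b' = A' b') → W𝒱w V A c' = W𝒱w V A' c') {rW : ℝ}
    (hreachW : ∀ c' b', NW c' b' → ϖw (posz c') - rW ≤ ϖw (pos b')) {rC : ℝ}
    (hreachC : ∀ (c' : ↥Sw') (b' : ↥Sw),
      BondIn (loK P.L k c'.1.1) (bondHiK P.L k c'.1.1 c'.1.2) b'.1.1 b'.1.2 → ϖw (posx c') - rC ≤ ϖw (pos' b'))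
    (hsupp : ∀ V, ∀ z : Fin m₀ → ℂ, ∀ i, 0 < ϖw (posb i) → Tw V z i = 0)
    (hqW : c𝒢 * M𝒢 * (4 * C₄w * (ε₄w + B₀w * bw) * Real.exp (δw * rW)) < 1)
    (hk : 12 * C2cov P.d * (ε₄w + B₀w * bw) * Real.exp (δw * rC) * (cι * Mι) * (cH * MH) < 1)
    -- weight plaquettes; read-outs BLIND off located supports, FLAT op-norms, curl op-norm (DISPLAYED; `κ_c ∝ η²`), lengths
    {𝔭 : Type*} (Pw : Finset 𝔭) (ℓw : 𝔭 → List ((Λw → 𝔄w) →L[ℂ] Matrix n n ℂ)) (suppw : 𝔭 → Finset Λw) (ϖPw : 𝔭 → ℝ)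
    (hblindw : ∀ p ∈ Pw, ∀ ℓ ∈ ℓw p, ∀ A A' : Λw → 𝔄w, (∀ b' ∈ suppw p, A b' = A' b') → ℓ A = ℓ A')
    (hdepthw : ∀ p ∈ Pw, ∀ b' ∈ suppw p, ϖPw p ≤ ϖw (pos b')) (hϖPw : ∀ p ∈ Pw, 0 ≤ ϖPw p) {κwb κcb : ℝ}
    (hκwb : 0 ≤ κwb) (hκcb : 0 ≤ κcb) (hℓwb : ∀ p ∈ Pw, ∀ ℓ ∈ ℓw p, ‖ℓ‖ ≤ κwb) (hcurlw : ∀ p ∈ Pw, ‖(ℓw p).sum‖ ≤ κcb)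
    {mw : ℕ} (hlenw : ∀ p ∈ Pw, (ℓw p).length ≤ mw)
    -- the global tuple's real structure with SKEW weight read-outs
    (𝓡𝒴w : AddSubgroup (Λw → 𝔄w)) (h𝓡𝒴w : IsClosed (𝓡𝒴w : Set (Λw → 𝔄w))) (𝓡𝒵w : AddSubgroup (Λz → ℭ))
    (𝓡ℬw : AddSubgroup (Λb → 𝔇)) (h𝒢rw : ∀ V, ∀ f ∈ 𝓡𝒵w, kerOp (k𝒢 V) f ∈ 𝓡𝒴w) (hWrw : ∀ V, ∀ Y ∈ 𝓡𝒴w, W𝒱w V Y ∈ 𝓡𝒵w)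
    (hιrw : ∀ V, ∀ Y ∈ 𝓡𝒴w, kerOp (kι V) Y ∈ skewPi ↥Sw)
    (hHrw : ∀ V, ∀ X ∈ skewPi (𝔸 := 𝔸) ↥Sw', kerOp (kH V) X ∈ 𝓡𝒴w) (hH₁rw : ∀ V, ∀ B ∈ 𝓡ℬw, kerOp (kH₁ V) B ∈ 𝓡𝒴w)
    (hTrw : ∀ V (y : Fin m₀ → ℝ), Tw V (cplx y) ∈ 𝓡ℬw)
    (hskew : ∀ p ∈ Pw, ∀ ℓ ∈ ℓw p, ∀ Y ∈ 𝓡𝒴w, ℓ Y ∈ skewAdjoint (Matrix n n ℂ))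
    -- the frozen background plaquettes (N-ne7cp1-g31-2) with a uniform size bound, the located count, `0 ≤ β`
    (Bp : GaugeField P j SU2 → 𝔭 → Matrix n n ℂ) {d : 𝔭 → ℝ} {dbar : ℝ}
    (hBu : ∀ V, ∀ p ∈ Pw, Bp V p ∈ unitary (Matrix n n ℂ)) (hBd : ∀ V, ∀ p ∈ Pw, ‖Bp V p - 1‖ ≤ d p)
    (hd : ∀ p ∈ Pw, d p ≤ dbar) (hdbar : 0 ≤ dbar) {Kw : ℝ} (hKw : ∑ p ∈ Pw, Real.exp (-(δw * ϖPw p)) ≤ Kw)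
    -- ══ (T3) THE LOCATED NON-WILSON TERMS — THE 𝓔-LEG READ OFF THE w-TUPLE's KERNELS IN THE PINNED DRESS (S113, leaf-01-g11:
    -- `hE_landau_chartRay_pinned_w`): ONE exponent field; the e-tuple's carriers and letters are GONE; ENTERING the pin sign, the three
    -- Schur number junctions (S108's rows, born here) and the pinned restriction row; the e-leg's own numbers, its Landau-correction
    -- pair (between the pinned spaces), the TERM rows and the coupling STAY ══
    (hϖ0 : ∀ x, 0 ≤ ϖw x) (hB𝒢w : c𝒢 * M𝒢 ≤ B₀w) (hBH₁w : cH₁ * MH₁ ≤ B₀w) (hBHw : cH * MH ≤ B₀w) {ε₄e : ℝ}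
    (hε₄e : 0 ≤ ε₄e) (hdome : 2 * (ε₄e + B₀w * bw) ≤ a₃w)
    (hselfe : B₀w * (C₄w * Real.exp (δw * rW)) * (ε₄e + B₀w * bw) ^ 2 ≤ ε₄e)
    (hcontre : 4 * B₀w * (C₄w * Real.exp (δw * rW)) * (ε₄e + B₀w * bw) < 1)
    (hιew : ∀ V, ∀ Y : WSup (pinW δw (ϖw ∘ pos)) 1 𝔄w, ‖kerOpPin (kι V) δw (ϖw ∘ pos) (ϖw ∘ pos') Y‖ ≤ ‖Y‖)
    (hqe : 9 * (C2cov P.d * Real.exp (2 * δw * rC)) * B₀w * (ε₄e + B₀w * bw) < 1)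
    (hRCe : 3 * (ε₄e + B₀w * bw) ≤ landauRad P.d P.L) {𝔱 : Type*} (I : Finset 𝔱) {Ef : 𝔱 → (Λw → 𝔄w) → ℂ} {rE : ℝ}
    {ee : 𝔱 → ℝ} (hrE : 0 < rE) (hEd : ∀ i ∈ I, DifferentiableOn ℂ (Ef i) (ball 0 rE))
    (hEb : ∀ i ∈ I, ∀ Z ∈ ball (0 : Λw → 𝔄w) rE, ‖Ef i Z‖ ≤ ee i) (he0 : ∀ i ∈ I, 0 ≤ ee i) (supp : 𝔱 → Finset Λw)
    (hblind : ∀ i ∈ I, ∀ A₁ A₂ : Λw → 𝔄w, (∀ b' ∈ supp i, A₁ b' = A₂ b') → Ef i A₁ = Ef i A₂) (ϖP : 𝔱 → ℝ)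
    (hdepth : ∀ i ∈ I, ∀ b' ∈ supp i, ϖP i ≤ ϖw (pos b')) {LK : ℝ} (hLK : 0 ≤ LK)
    (hK : ∑ i ∈ I, 2 * ee i / rE * Real.exp (-(δw * ϖP i)) ≤ LK)
    (hcoupE : ((ε₄e + B₀w * bw) + B₀w * (4 * (C2cov P.d * Real.exp (2 * δw * rC)) * (ε₄e + B₀w * bw) ^ 2)) ≤ rE / 2)
    {BE₁ : ℝ}
    (hElb₁ : ∀ V (y : Fin m₀ → ℝ), ‖y‖ ≤ S → -BE₁ ≤
      (∑ i ∈ I, Ef i (WSup.toPiL (pinW δw (ϖw ∘ pos)) 1 (landauExp (fun Y : WSup (pinW δw (ϖw ∘ pos')) 1 𝔸 =>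
            ((toPiL (pinW δw (ϖw ∘ posx)) 1).symm (landauCfBox P.L (Ubg V) k Sw Sw' (landauRad P.d P.L) (toPiL (pinW δw (ϖw ∘ pos')) 1 Y)) :
              WSup (pinW δw (ϖw ∘ posx)) 1 𝔸))
        (kerOpPin (kι V) δw (ϖw ∘ pos) (ϖw ∘ pos')) (kerOpPin (kH V) δw (ϖw ∘ posx) (ϖw ∘ pos))
        (4 * (C2cov P.d * Real.exp (2 * δw * rC)) * (ε₄e + B₀w * bw) ^ 2)
        (solAt (kerOpPin (k𝒢 V) δw (ϖw ∘ posz) (ϖw ∘ pos)) 0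
          (fun Y : WSup (pinW δw (ϖw ∘ pos)) 1 𝔄w =>
            ((toPiL (pinW δw (ϖw ∘ posz)) 1).symm (W𝒱w V (toPiL (pinW δw (ϖw ∘ pos)) 1 Y)) : WSup (pinW δw (ϖw ∘ posz)) 1 ℭ))
          ε₄e (0 : WSup (pinW δw (ϖw ∘ posz)) 1 ℭ)
          (kerOpPin (kH₁ V) δw (ϖw ∘ posb) (ϖw ∘ pos) ((toPiL (pinW δw (ϖw ∘ posb)) 1).symm (Tw V (cplx y)))) +
            kerOpPin (kH₁ V) δw (ϖw ∘ posb) (ϖw ∘ pos) ((toPiL (pinW δw (ϖw ∘ posb)) 1).symm (Tw V (cplx y))))))).re)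
    -- ══ (S78) THE FLUCTUATION-DRESSED TERMS: `−log ∫ g e^{A} dμ` with an ω-UNIFORM ray constant `B_d`, integrability and
    -- positivity of the dressed integral, a lower bound on the S-ball (all DISPLAYED) ══
    {Ω : Type*} [MeasurableSpace Ω] (μ : Measure Ω) {g : Ω → ℝ} (hg : ∀ ω, 0 ≤ g ω)
    (A : GaugeField P j SU2 → (Fin m₀ → ℝ) → Ω → ℝ) {Bd : ℝ} (hBd0 : 0 ≤ Bd)
    (hint : ∀ V, ∀ x ∈ W V, ∀ c : ℝ, 1 / 2 ≤ c → c ≤ 1 → Integrable (fun ω => g ω * Real.exp (A V (c • x) ω)) μ)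
    (hpos : ∀ V, ∀ x ∈ W V, ∀ c : ℝ, 1 / 2 ≤ c → c ≤ 1 → 0 < ∫ ω, g ω * Real.exp (A V (c • x) ω) ∂μ)
    (hA : ∀ V, ∀ x ∈ W V, ∀ c : ℝ, 1 / 2 ≤ c → c ≤ 1 → ∀ ω, A V x ω ≤ A V (c • x) ω + (1 - c) * Bd) {BE₂ : ℝ}
    (hElb₂ : ∀ V (y : Fin m₀ → ℝ), ‖y‖ ≤ S → -BE₂ ≤ (-Real.log (∫ ω, g ω * Real.exp (A V y ω) ∂μ)))
    (L : Set (𝒴 →L[ℂ] Matrix n n ℂ)) (𝓡𝒵 : AddSubgroup 𝒵) (𝓡ℬ : AddSubgroup ℬ)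
    (h𝒢r : ∀ V, ∀ f ∈ 𝓡𝒵, 𝒢 V f ∈ readOutReal L) (hWr : ∀ V, ∀ Y ∈ readOutReal L, W𝒱 V Y ∈ 𝓡𝒵)
    (hιr : ∀ V, ∀ Y ∈ readOutReal L, ιs V Y ∈ skewPi ↥Sf)
    (hHr : ∀ V, ∀ X ∈ skewPi (𝔸 := 𝔸) ↥Sf', Hop V X ∈ readOutReal L) (hH₁r : ∀ V, ∀ B ∈ 𝓡ℬ, H₁ V B ∈ readOutReal L)
    (hTr : ∀ V (y : Fin m₀ → ℝ), T V (cplx y) ∈ 𝓡ℬ)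
    (hudict : ∀ V, ∀ x ∈ cube m₀ S,
      u (fixTo (combBonds lo hi) 1 (updateFinset V Λ (expFibreChart Λ 1 e x))) =
        classifier hPu (fun p => holOf (ℓs p) (fun y => landauExp ((ball (0 : ↥Sf → 𝔸) (landauRad P.d P.L)).indicator
            (landauCf P.L (1 : B7Prop1Explicit.Site P.d → Fin P.d → 𝔸ˣ) k Sf Sf')) (ιs V) (Hop V)
          (4 * C2cov P.d * (ε₄ + B₀ * (2 * dL * C₁ * ε₁)) ^ 2)
          (solAt (𝒢 V) 0 (W𝒱 V) ε₄ (0 : 𝒵) (H₁ V (T V (cplx y))) + H₁ V (T V (cplx y))))) x)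
    (hRdict : ∀ V, ∀ x ∈ cube m₀ S, F (fixTo (combBonds lo hi) 1 (updateFinset V Λ (expFibreChart Λ 1 e x))) = Jco V
      x * ENNReal.ofReal (Real.exp (-((∑ p ∈ Pw, β * (1 - (Matrix.trace (Bp V p * holOf (ℓw p) (fun y =>
      landauExp (landauCfBox P.L (Ubg V) k Sw Sw' (landauRad P.d P.L)) (kerOp (kι V)) (kerOp (kH V)) (4 * C2cov P.d * (ε₄w + B₀w * bw) ^ 2) (solAt (kerOp (k𝒢 V)) 0
      (W𝒱w V) ε₄w (0 : Λz → ℭ) (kerOp (kH₁ V) (Tw V (cplx y))) + kerOp (kH₁ V) (Tw V (cplx y)))) x)).re /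
      Fintype.card n)) + ((∑ i ∈ I, Ef i (WSup.toPiL (pinW δw (ϖw ∘ pos)) 1 (landauExp (fun Y : WSup (pinW δw (ϖw ∘ pos')) 1 𝔸 =>
            ((toPiL (pinW δw (ϖw ∘ posx)) 1).symm (landauCfBox P.L (Ubg V) k Sw Sw' (landauRad P.d P.L) (toPiL (pinW δw (ϖw ∘ pos')) 1 Y)) :
              WSup (pinW δw (ϖw ∘ posx)) 1 𝔸)) (kerOpPin (kι V)
      δw (ϖw ∘ pos) (ϖw ∘ pos')) (kerOpPin (kH V) δw (ϖw ∘ posx) (ϖw ∘ pos)) (4 * (C2cov P.d * Real.exp (2 * δw * rC)) * (ε₄e + B₀w * bw) ^ 2)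
      (solAt (kerOpPin (k𝒢 V) δw (ϖw ∘ posz) (ϖw ∘ pos)) 0 (fun Y : WSup (pinW δw (ϖw ∘ pos)) 1 𝔄w => ((toPiL
      (pinW δw (ϖw ∘ posz)) 1).symm (W𝒱w V (toPiL (pinW δw (ϖw ∘ pos)) 1 Y)) : WSup (pinW δw (ϖw ∘ posz)) 1 ℭ))
      ε₄e (0 : WSup (pinW δw (ϖw ∘ posz)) 1 ℭ) (kerOpPin (kH₁ V) δw (ϖw ∘ posb) (ϖw ∘ pos) ((toPiL (pinW δw (ϖw
      ∘ posb)) 1).symm (Tw V (cplx x)))) + kerOpPin (kH₁ V) δw (ϖw ∘ posb) (ϖw ∘ pos) ((toPiL (pinW δw (ϖw ∘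
      posb)) 1).symm (Tw V (cplx x))))))).re + (-Real.log (∫ ω, g ω * Real.exp (A V x ω) ∂μ)))))))
    (hJW : ∀ V x, Jco V x ≠ 0 → x ∈ W V) (hJ : ∀ V x, ∀ a : ℝ, 0 ≤ a → Jco V x ≤ Jco V (Real.exp (-a) • x))
    (hJ1 : ∀ V x, Jco V x ≤ 1) (hWS : ∀ V, W V ⊆ closedBall (0 : Fin m₀ → ℝ) S) (hδ0 : 0 ≤ δ) (hδ1 : δ < 1)
    (hρ0 : 0 ≤ ρ) (hρ : ρ ≤ (1 - δ) / 2) (hβ : 0 ≤ β)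
    -- SM-L2 (SM) DISCHARGED IN THE STOKES CURRENCY (S73 `hSM_of_stokes`): the η-scalings of the classifier's read-out data
    -- DISPLAYED — curl read-out × field size `κ_c·z̄ ≤ c₁η²z` (B11 (25)∕(37) TYPE), letter size `κ_r·z̄ ≤ c₂ηz` ((19) TYPE),
    -- regime `m·κ_r·z̄ ≤ 1` — the UNIT-currency smallness `36(c₁z + m²c₂²z²)∕(r_Φ∕S − 1)² ≤ δ·εθ`, and the classifier
    -- threshold `θ := εθ·η²` (B14 (2.17) TYPE): the `η²` CANCELS
    {η εθ c₁ c₂ z : ℝ} (hη : 0 < η) (hεθ : 0 < εθ)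
    (hs₁ : κc * ((ε₄ + B₀ * (2 * dL * C₁ * ε₁)) + B₀ * (4 * C2cov P.d * (ε₄ + B₀ * (2 * dL * C₁ * ε₁)) ^ 2)) ≤ c₁ * η ^ 2 * z)
    (ha : κr * ((ε₄ + B₀ * (2 * dL * C₁ * ε₁)) + B₀ * (4 * C2cov P.d * (ε₄ + B₀ * (2 * dL * C₁ * ε₁)) ^ 2)) ≤ c₂ * η * z)
    (hma : m * (κr * ((ε₄ + B₀ * (2 * dL * C₁ * ε₁)) + B₀ * (4 * C2cov P.d * (ε₄ + B₀ * (2 * dL * C₁ * ε₁)) ^ 2))) ≤ 1)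
    (hsm : 36 * (c₁ * z + m ^ 2 * c₂ ^ 2 * z ^ 2) / (rΦ / S - 1) ^ 2 ≤ δ * εθ)
    -- THE DISPLAYED γ3 INPUT OF RECORD (N-ne7cp1-g32-2 ∕ N-ne7cp1-g33-2 «COLLAR»; leaf-01-g8 l.18489, leaf-08-g14 l.18568):
    -- radius `(d−1)·nb·a ≤ 2 sin(S∕2)`, a cover of the box plaquettes by a CORE set (⊇ the plaquettes of `□^∼`) and a COLLAR
    -- set, and the PAIR of readings — «sub-threshold ⟹ core plaquettes `a`-small» (B14 (2.16)–(2.17) + average regularity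
    -- [Balaban1985Averaging] Props 1∕2 TYPE, from `u < θ`) and «`F ≠ 0` ⟹ collar plaquettes `a`-small» (the density's KEPT
    -- co-tests, B15 (1.3)–(1.9) TYPE — a SUPPORT property); located, NOT asserted — REPLACE `hreach′` of file 1 (hence
    -- `hFsupp` of S80 f3); binder NAMES = S87 f4's (`hn hN hΛbox hΛcomb ha0 hrad hcover hcore hcollar`; the two plaquette
    -- sets are called `Pcore`∕`Pcollar` here because S80 f3 already uses `A` for the (S78) dressed action)
    {a : ℝ} (ha0 : 0 ≤ a) (hrad : ((P.d - 1 : ℕ) : ℝ) * nb * a ≤ 2 * Real.sin (S / 2))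
    {Pcore Pcollar : Set (Plaq P j)} (hcover : boxPlaqs lo hi ⊆ Pcore ∪ Pcollar)
    (hcore : ∀ (V : GaugeField P j SU2) (y : ↥Λ → SU2),
      u (fixTo (combBonds lo hi) 1 (updateFinset V Λ y)) < εθ * η ^ 2 →
        PlaqSmallOn Pcore a (fixTo (combBonds lo hi) 1 (updateFinset V Λ y)))
    (hcollar : ∀ (V : GaugeField P j SU2) (y : ↥Λ → SU2),
      F (fixTo (combBonds lo hi) 1 (updateFinset V Λ y)) ≠ 0 →
        PlaqSmallOn Pcollar a (fixTo (combBonds lo hi) 1 (updateFinset V Λ y))) :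
    SlotAntiConcentration ((fieldMeasure P j SU2).withDensity F) u (εθ * η ^ 2) ρ
      (2 * ((m₀ : ℝ) + (3 * (|β| * ((dbar +
          2 * (κcb * (cH₁ * MH₁ * bw / ((1 - c𝒢 * M𝒢 * (4 * C₄w * (ε₄w + B₀w * bw) * Real.exp (δw * rW))) *
              (1 - 12 * C2cov P.d * (ε₄w + B₀w * bw) * Real.exp (δw * rC) * (cι * Mι) * (cH * MH)))) +
            expTail₂ (mw * (κwb * (cH₁ * MH₁ * bw / ((1 - c𝒢 * M𝒢 * (4 * C₄w * (ε₄w + B₀w * bw) * Real.exp (δw * rW))) *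
              (1 - 12 * C2cov P.d * (ε₄w + B₀w * bw) * Real.exp (δw * rC) * (cι * Mι) * (cH * MH))))))) / (rΦw / S)) *
          (2 * (κcb * (cH₁ * MH₁ * bw / ((1 - c𝒢 * M𝒢 * (4 * C₄w * (ε₄w + B₀w * bw) * Real.exp (δw * rW))) *
              (1 - 12 * C2cov P.d * (ε₄w + B₀w * bw) * Real.exp (δw * rC) * (cι * Mι) * (cH * MH)))) +
            expTail₂ (mw * (κwb * (cH₁ * MH₁ * bw / ((1 - c𝒢 * M𝒢 * (4 * C₄w * (ε₄w + B₀w * bw) * Real.exp (δw * rW))) *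
              (1 - 12 * C2cov P.d * (ε₄w + B₀w * bw) * Real.exp (δw * rC) * (cι * Mι) * (cH * MH))))))) / (rΦw / S))) * Kw) +
        (3 * (LK * (2 * ((ε₄e + B₀w * bw) + B₀w * (4 * (C2cov P.d * Real.exp (2 * δw * rC)) * (ε₄e + B₀w * bw) ^ 2)))) / (rΦw / S - 1) + Bd))) / (1 - δ)) := by
  exact slotAC_realized_su2_landauChart_assembled_decay_v6_cfB7 hn hN Λ hΛbox hΛcomb e hS hSπ hF hFi hu hui hPu W Jco 𝒢 W𝒱
    h𝒢 hW hB₀ hC₄ hε₄ hdL hC₁ hε₁ hB₃ h1 h2 h3 H₁ hH₁ (fun V => ⇑(T V)) (hΦd_of_linear T rΦ) (hΦ0_of_linear T)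
    (hΦ_of_linear T hTb) hSr k Sf Sf' Sw Sw' Ubg hUbg hα hα3 hα4 hα6 h52locw ιs hι Hop hH h18 hcoup h3R ℓs hκ hℓ hlen
    hκc hcurl hδw ϖw dis hϖw pos posz pos' posx posb k𝒢 kι kH kH₁ hc𝒢 hM𝒢 hk𝒢 hM𝒢' hcι hMι hkι hMι' hcH hMH hkH hMH'
    hcH₁ hMH₁ hkH₁ hMH₁' W𝒱w h𝒢w hWw hB₀w hC₄w hε₄w hdomw hselfw hcontrw hH₁w (fun V => ⇑(Tw V)) (hΦd_of_linear Tw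
    rΦw) (hΦ0_of_linear Tw) (hΦ_of_linear Tw hTbw) h2Sw hιw hHw hqw hRCw NW hlocW hreachW hreachC hsupp hqW hk Pw ℓw
    suppw ϖPw hblindw hdepthw hϖPw hκwb hκcb hℓwb hcurlw hlenw 𝓡𝒴w h𝓡𝒴w 𝓡𝒵w 𝓡ℬw h𝒢rw hWrw hιrw hHrw hH₁rw
    (hΦr_of_linear Tw 𝓡ℬw hTrw S) hskew Bp hBu hBd hd hdbar hKw hϖ0 hB𝒢w hBH₁w hBHw hε₄e hdome hselfe hcontre hιew hqe
    hRCe I hrE hEd hEb he0 supp hblind ϖP hdepth hLK hK hcoupE hElb₁ μ hg A hBd0 hint hpos hA hElb₂ L 𝓡𝒵 𝓡ℬ h𝒢r hWr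
    hιr hHr hH₁r (hΦr_of_linear T 𝓡ℬ hTr S) hRdict hudict hJW hJ hJ1 hWS hδ0 hδ1 hρ0 hρ hβ hη hεθ hs₁ ha hma hsm ha0
    hrad hcover hcore hcollar

end Box

end Summit.QuantumFields.BalabanUV.T4Continuum.ShellMeasureLandauEndAssembledDecayCfLinV6

end
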